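import Literature.AlgebraicGeometry.HodgeTheory.MotivatedClassesPushforward
import Literature.AlgebraicGeometry.HodgeTheory.MotivatedClassesAlgebraic
import Literature.AlgebraicGeometry.HodgeTheory.GysinBaseChange
import HarnessLib

/-!
# André 1996 Prop. 2.1 (ii), first inclusion `pr_X^*(A_motᵖ(X)) ⊆ A_motᵖ(X ⊗ Z)` — reduction to its
# Künneth core by Gysin base change (singular cohomology of smooth projective complex varieties)

The stub is Y. André, *Pour une théorie inconditionnelle des motifs*, Publ. Math. IHÉS 83 (1996),
Prop. 2.1 (ii), first inclusion: `pr^{XZ*}_X A_motᵖ(X)_ℂ ⊆ A_motᵖ(X × Z)_ℂ`, on the real carriers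
(`motivatedClasses`, `complexBetti.map (fst X Z)`). André's proof (p. 15) has two steps:

1. (base change and functoriality) for a generator `x = pr^{XY}_{X*}(α ∪ *_η β)` of `A_mot(X)`,
   `pr^{XZ*}_X x = pr^{XZY}_{XZ*}(pr^{XZY*}_{XY}(α ∪ *_η β)) = pr^{XZY}_{XZ*}(pr^* α ∪ pr^*(*_η β))`;
2. (Künneth core) `pr^*(*_η β) = *_η β ⊗ [Z]` is rewritten through the Lefschetz involution of the
   PRODUCT polarisation of `(X × Y) × Z` ("on conclut en appliquant le lemme 1.3.2"), which makes the
   right-hand side a combination of generators of `A_mot(X × Z)` with auxiliary variety `Y` (or `Y × Z`).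

Step 2 is André's Lemme 1.3.2, absent on the real carriers (the tree has it over an abstract Weil
cohomology, `Motives/LefschetzStarExternalProduct`, under the axiom `HasProdHyperplaneClasses`).
Step 1 is available: the Gysin base change for the cartesian square of projections is PROVED on
the real carriers (`gysin_baseChange`, `HodgeTheory/GysinBaseChange`, from the Künneth spanning
property, with an explicit scalar), as is the multiplicativity of pull-back (`cupProduct_map`).

* `motivatedPullbackFst_of_core` (and its implication form `stub_motivatedPullbackFst_of_core`, the
  registered sub-goal) — **the stub follows from its Künneth core**: IF for all
  smooth projective `Z`, `X`, `Y` (dimensions `l`, `n`, `m`), every orientation family `μ`, every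
  polarisation class `η` of `X ⊗ Y`, all algebraic `α ∈ Nᵃ`, `β ∈ Nᵇ` on `X ⊗ Y`
  (`b + b' = n + m`, `a + b' = p + m`, `p ≤ n`) the class
  `(Z ◁ pr_X)_*(pr_{XY}^* α ∪ pr_{XY}^*(*_η β)) ∈ H²ᵖ((Z ⊗ X)(ℂ); ℂ)` — push-forward along
  `Z ◁ fst X Y : Z ⊗ (X ⊗ Y) ⟶ Z ⊗ X` of the pull-back along `snd Z (X ⊗ Y)` — lies in
  `A_motᵖ(Z ⊗ X)_ℂ` (hypothesis `hcore`, step 2 verbatim after step 1), THEN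
  `pr_X^*(A_motᵖ(X)) ⊆ A_motᵖ(X ⊗ Z)` for all `X`, `Z`, `p`. Proof: on a generator, the orientations
  `μ₀`, `ν₀` of the generator are unit multiples of those of `μ` (`(X ⊗ Y)(ℂ)`, `X(ℂ)` connected,
  Hatcher Thm. 3.26), under which the Gysin map rescales (`gysinMap_eq_smul_of_fundamentalClass_eq`);
  `pr_X^{ZX*} ∘ pr^{XY}_{X*} = c • (Z ◁ pr_X)_* ∘ pr_{XY}^{Z(XY)*}` (`gysin_baseChange`); pull-back is
  multiplicative (`cupProduct_map`); and `fst X Z = σ ≫ snd Z X` for the swap `σ : X ⊗ Z ≅ Z ⊗ X`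
  (`map_mem_motivatedClasses_of_iso`).

So the one missing input of the stub on the real carriers is `hcore` — André's Lemme 1.3.2 for the
pair `(*_η β, [Z])` through Künneth, together with the hard Lefschetz property of the exterior sum
`η ⊠ 1 + 1 ⊠ η_Z` (André §1.3, the `𝔰𝔩₂`-equivariance of Künneth) that makes it a polarisation
class of `Z ⊗ (X ⊗ Y)` in the sense of `IsPolarizationClass`.

No definition and no named fact is introduced; `hcore` is a verbatim hypothesis.

## References

* [Andre1996Motifs] Y. André, Pour une théorie inconditionnelle des motifs, Publ. Math. IHÉS 83
  (1996) 5–49: Prop. 2.1 (ii) (p. 14) and proof (p. 15), §1.3 Lemme 1.3.2 (p. 13).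
* [Fulton1998] W. Fulton, Intersection Theory, 2nd ed., Springer 1998, Prop. 1.7.
* [FultonYoungTableaux1997] W. Fulton, Young Tableaux, CUP 1997, App. B §B.1 (2), (5), (6).
* [HatcherAT2002] A. Hatcher, Algebraic Topology, CUP 2002, §3.2 Prop. 3.10, §3.3 Thm. 3.26.

Provenance: Literature home (family `hodge`, layer `Literature/AlgebraicGeometry/HodgeTheory`, namespace
`Literature.AlgebraicGeometry.HodgeTheory.MotivatedPullback`) of the Summits-side `Theorems/HeckePrymWeilSummitOffWeilSectorMotivatedPullbackFstReduction` (cell `pub-hodge-ring2` ∕ route files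
`HeckePrymWeilSummitOffWeilSector*`, the tree's derivation of André 1996 Prop. 2.1 (ii): motivated classes are stable
under pull-back), which `Literature/` may not import; theorems only, no named fact, no definition. Nothing here bears
on `HC_CM`; no case of the Hodge conjecture is proved. Lane `lit-hodgefound`, seat p20.
-/

noncomputable section

open _root_.CategoryTheory _root_.AlgebraicGeometry MonoidalCategory CartesianMonoidalCategory
open Literature.AlgebraicTopology.SingularHomology Literature.Geometry.Kaehler
open Literature.AlgebraicGeometry Literature.AlgebraicGeometry.Motives
  Literature.AlgebraicGeometry.HodgeTheory

namespace Literature.AlgebraicGeometry.HodgeTheory.MotivatedPullback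

/-- **André's Prop. 2.1 (ii), first inclusion, from its Künneth core** (André 1996, p. 15:
"`pr^{XZ*}_X pr^{XY}_{X*}(α ∪ *β) = pr^{XZY}_{XZ*}(pr^{XZY*}_{XY} α ∪ pr^{XZY*}_{XY}(*β))` … et l'on
conclut en appliquant le lemme 1.3.2"), on the real carriers. GRANTED `hcore` — for `Z`, `X`, `Y`
smooth projective of dimensions `l`, `n`, `m`, an orientation family `μ`, a polarisation class `η`
of `X ⊗ Y`, algebraic `α ∈ Nᵃ H²ᵃ((X ⊗ Y)(ℂ))`, `β ∈ Nᵇ H²ᵇ((X ⊗ Y)(ℂ))` and degrees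
`b + b' = n + m`, `a + b' = p + m`, `p ≤ n`, the class
`(Z ◁ pr_X)_*(pr_{XY}^* α ∪ pr_{XY}^*(*_η β))` lies in `A_motᵖ(Z ⊗ X)_ℂ` (the content of Lemme 1.3.2
through Künneth; `(Z ◁ pr_X)_* = complexGysin μ` along `Z ◁ fst X Y : Z ⊗ (X ⊗ Y) ⟶ Z ⊗ X`,
`pr_{XY} = snd Z (X ⊗ Y)`) — every `x ∈ A_motᵖ(X)_ℂ` has `pr_X^* x ∈ A_motᵖ(X ⊗ Z)_ℂ`. On a
generator `x = pr_{X*}(α ∪ *_η β)` (orientations `μ₀`, `ν₀` with Poincaré duality): `μ₀`, `ν₀` are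
unit multiples `u • μ_{X ⊗ Y}`, `v • μ_X` of the orientations of the family (the closed manifolds
`(X ⊗ Y)(ℂ)`, `X(ℂ)` are connected, Hatcher Thm. 3.26 (b)), so `pr_{X*} = v⁻¹ u • complexGysin μ pr_X`
(`gysinMap_eq_smul_of_fundamentalClass_eq`); the Gysin base change of the cartesian square
`Z ⊗ (X ⊗ Y) → X ⊗ Y` over `Z ⊗ X → X` (Fulton Prop. 1.7; the tree's `gysin_baseChange`, with a
scalar `c`) gives `pr_X^{ZX*}(pr_{X*} w) = c • (Z ◁ pr_X)_*(pr_{XY}^* w)`; pull-back is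
multiplicative (Hatcher Prop. 3.10, `cupProduct_map`); so `pr_X^{ZX*} x` is a scalar multiple of
the class of `hcore`, in `A_motᵖ(Z ⊗ X)`; finally `pr_X^{XZ} = σ ≫ pr_X^{ZX}` for the swap
`σ : X ⊗ Z ≅ Z ⊗ X`, and motivated classes transport along isomorphisms
(`map_mem_motivatedClasses_of_iso`). For `p > n`, `H²ᵖ(X(ℂ); ℂ) = 0`.
[cite: Andre1996Motifs, Prop. 2.1 (ii) (p. 14) and proof (p. 15)] [cite: Fulton1998, Prop. 1.7]
[cite: HatcherAT2002, §3.2 Prop. 3.10 and §3.3 Thm. 3.26] -/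
theorem motivatedPullbackFst_of_core
    (hcore : ∀ ⦃l n m : ℕ⦄ ⦃Z X Y : SchemeOver ℂ⦄ (hZ : IsSmoothProjective l Z)
      (hX : IsSmoothProjective n X) (hY : IsSmoothProjective m Y) (μ : OrientationFamily)
      ⦃η : complexBetti (X ⊗ Y) 2⦄ (hη : IsPolarizationClass (n + m) (X ⊗ Y) η) ⦃a b b' p : ℕ⦄
      (_ : b + b' = n + m) (_ : a + b' = p + m) (_ : p ≤ n)
      ⦃α : complexBetti (X ⊗ Y) (2 * a)⦄ ⦃β : complexBetti (X ⊗ Y) (2 * b)⦄,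
      α ∈ algebraicClasses (X ⊗ Y) a → β ∈ algebraicClasses (X ⊗ Y) b →
        complexGysin μ (IsSmoothProjective.tensor_holds hZ (IsSmoothProjective.tensor_holds hX hY))
            (IsSmoothProjective.tensor_holds hZ hX) (Z ◁ fst X Y)
            (show 2 * (p + m) + 2 * (l + n) = 2 * p + 2 * (l + (n + m)) by omega)
            (cupProduct (show 2 * a + 2 * b' = 2 * (p + m) by omega)
              (complexBetti.map (snd Z (X ⊗ Y)) (2 * a) α)
              (complexBetti.map (snd Z (X ⊗ Y)) (2 * b')
                (lefschetzInvolution hη.hasHardLefschetz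
                  (show 2 * b + 2 * b' = 2 * (n + m) by omega) β))) ∈
          motivatedClasses (l + n) (Z ⊗ X) p) :
    ∀ ⦃n l : ℕ⦄ ⦃X Z : SchemeOver ℂ⦄, IsSmoothProjective n X → IsSmoothProjective l Z →
      ∀ (p : ℕ), ∀ x ∈ motivatedClasses n X p,
        complexBetti.map (fst X Z) (2 * p) x ∈ motivatedClasses (n + l) (X ⊗ Z) p := by
  intro n l X Z hX hZ p
  classical
  have hXZ : IsSmoothProjective (l + n) (X ⊗ Z) := by
    rw [Nat.add_comm]
    exact IsSmoothProjective.tensor_holds hX hZ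
  have hZX : IsSmoothProjective (l + n) (Z ⊗ X) := IsSmoothProjective.tensor_holds hZ hX
  -- the swap `σ : X ⊗ Z ≅ Z ⊗ X`, `σ ≫ pr_X^{ZX} = pr_X^{XZ}`
  suffices hsnd : ∀ x ∈ motivatedClasses n X p,
      complexBetti.map (snd Z X) (2 * p) x ∈ motivatedClasses (l + n) (Z ⊗ X) p by
    intro x hx
    obtain ⟨σ, hσ⟩ : ∃ σ : X ⊗ Z ≅ Z ⊗ X, σ.hom ≫ snd Z X = fst X Z :=
      ⟨⟨lift (snd X Z) (fst X Z), lift (snd Z X) (fst Z X),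
        CartesianMonoidalCategory.hom_ext _ _ (by simp) (by simp),
        CartesianMonoidalCategory.hom_ext _ _ (by simp) (by simp)⟩, lift_snd _ _⟩
    rw [← hσ, complexBetti.map_comp, CategoryTheory.comp_apply, Nat.add_comm n l]
    exact map_mem_motivatedClasses_of_iso hZX hXZ σ (hsnd x hx)
  -- above the top degree there is nothing to prove
  by_cases hp : p ≤ n
  swap
  · intro x _
    haveI := subsingleton_complexBetti hX (show 2 * n < 2 * p by omega)
    rw [Subsingleton.elim x 0, map_zero]
    exact Submodule.zero_mem _
  -- reduce to a generator `pr_{X*}(α ∪ *_η β)`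
  suffices hle : motivatedClasses n X p ≤
      (motivatedClasses (l + n) (Z ⊗ X) p).comap (complexBetti.map (snd Z X) (2 * p)).hom from
    fun x hx ↦ hle hx
  rw [motivatedClasses_le_iff]
  rintro y ⟨m, Y, hY, μ₀, ν₀, hμ₀, hν₀, η, hη, a, b, b', q, hbb', hab, hq, α, β, hα, hβ, rfl⟩
  rw [Submodule.mem_comap]
  change complexBetti.map (snd Z X) (2 * p) _ ∈ _
  -- an orientation family `μ`; the generator's orientations are unit multiples of `μ`'s
  obtain ⟨μ, hμ⟩ : ∃ μ : OrientationFamily, μ.HasPoincareDuality :=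
    ⟨fun _ _ h ↦ Classical.choice (ComplexPoints.isOrientableOver ℂ h),
      OrientationFamily.hasPoincareDuality _⟩
  have hXY : IsSmoothProjective (n + m) (X ⊗ Y) := IsSmoothProjective.tensor_holds hX hY
  letI := hXY.chartedSpace
  haveI := ComplexPoints.compactSpace_of_isSmoothProjective hXY
  haveI := ComplexPoints.t2Space_of_isSmoothProjective hXY
  haveI : ConnectedSpace (ComplexPoints (X ⊗ Y)) := connectedSpace_complexPoints hXY
  obtain ⟨u, hu, -⟩ := (μ hXY).exists_unit_fundamentalClass_eq_smul μ₀
  have hv : ∃ v : ℂˣ, ν₀.fundamentalClass = (v : ℂ) • (μ hX).fundamentalClass := by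
    letI := hX.chartedSpace
    haveI := ComplexPoints.compactSpace_of_isSmoothProjective hX
    haveI := ComplexPoints.t2Space_of_isSmoothProjective hX
    haveI : ConnectedSpace (ComplexPoints X) := connectedSpace_complexPoints hX
    obtain ⟨v, hv, -⟩ := (μ hX).exists_unit_fundamentalClass_eq_smul ν₀
    exact ⟨v, hv⟩
  obtain ⟨v, hv⟩ := hv
  have H₁ : 2 * (p + m) + 2 * q = 2 * (n + m) := by omega
  have H₂ : 2 * p + 2 * q = 2 * n := by omega
  have hchange : gysinMap μ₀ ν₀ (AlgPoints.mapContinuous (L := ℂ) (fst X Y)) H₁ H₂ =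
      ((v⁻¹ * u : ℂˣ) : ℂ) • gysinMap (μ hXY) (μ hX) (AlgPoints.mapContinuous (L := ℂ) (fst X Y)) H₁ H₂ :=
    gysinMap_eq_smul_of_fundamentalClass_eq (μ.hasPoincareDuality hX) hν₀ hu hv
      (by push_cast; rw [← mul_assoc, mul_inv_cancel₀ v.ne_zero, one_mul]) _ H₁ H₂
  rw [hchange, LinearMap.smul_apply, map_smul]
  refine Submodule.smul_mem _ _ ?_
  -- `pr_{X*}` as the Gysin morphism of the family, and the base change
  have hk : 2 * (p + m) + 2 * n = 2 * p + 2 * (n + m) := by omega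
  rw [← complexGysin_eq_gysinMap hXY hX (fst X Y) hk H₁ H₂]
  obtain ⟨c, hc⟩ := gysin_baseChange μ hZ hX hY hk
  rw [hc, cupProduct_map]
  exact Submodule.smul_mem _ _ (hcore hZ hX hY μ hη hbb' hab hp hα hβ)

end Literature.AlgebraicGeometry.HodgeTheory.MotivatedPullback

end
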